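import Literature.IUT.LogThetaLattice.PacketLogVolumesHaarModelCapsulesSingleton
import Literature.IUT.LogThetaLattice.GlobalKummerNonInterference
import HarnessLib

/-!
# [IUTchIII] Remark 3.10.1 (iii) — the degree ESTIMATE at the GENUINE capsule / tensor-packet Haar model,
# every finite nonempty label set `A` (abc-iut cell, layer L6; L-F register row LF6-11, F-2097; proof-only,
# no definitions)

S. Mochizuki, *Inter-universal Teichmüller theory III*, kurims manuscript (May 2020), §3, Remark 3.10.1
(iii), p. 150 [claim: Mochizuki2012, status: disputed]: "one may nevertheless compute — i.e., … 'estimate'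
— the global arithmetic degrees of objects of '`𝓕⊛_𝔪𝔬𝔡`' by computing log-volumes [cf. Proposition 3.9,
(iii)], which are bi-coric". Typed schema: `Literature.IUT.LogThetaLattice.Remark3101iii_estimate deg regionOf
vol := ∀ 𝔍 S, regionOf 𝔍 ⊆ S → deg 𝔍 ≤ vol S` (abc-iut-L6-t4, p407875; ∀-closure refuted p452607 — the instance
forms are the content).

Companion of `GlobalKummerNonInterferenceRemark3101iiiHaarModel.lean` (the `|A| = 1` genuine adelic Haar
model). THIS FILE: the same instance at the GENUINE `A`-PACKET model of Proposition 3.9 (i)/(iii) for EVERY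
finite nonempty label set `A` (abc-iut-L6-d3, `PacketLogVolumesHaarModelCapsulesGeneral.lean` p419250 /
`PacketLogVolumesHaarModelCapsulesSingleton.lean` p426201–p429279): regions at `v_ℚ` are families, over the
portions `π = (v_α)_{α∈A}`, of admissible subsets of the REAL tensor packets `⊗_{α,ℚ_p} F_{v_α}` (campaign-S
`PacketAlgebra`, log-volume `tensorLogVolume` = dimension-normalised Haar log-volume, [IUTchIV] Prop. 1.4 (i))
resp. `⊗_{α,ℝ} ℂ` (campaign-S `MI`, `packetLogVol`, [IUTchIV] Prop. 1.5 (iii)); `vol` = the global log-volume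
`globalLogVolume (capsulePacketLogVolume F A)`; regions of the objects `𝔍 = {J_v}` (`IdealFamily F`) in the
label `α` = `idealCapsuleRegion F A α` (`ι_α(J_{v_α})·(R_I)^∼` at `p`, the `α`-dilated unit polydisc at `∞`);
`deg 𝔍 = deg(𝔞_𝔍) = deg_F(𝔞_𝔍)/[F:ℚ]` (campaign-S `ndeg`); containment = portionwise inclusion of the underlying
admissible subsets (inline anonymous-constructor term for the schema's `HasSubset` argument; no instance
declared, the conclusion head is the FACT decl):

* `placeProbWeight_pos`, `portionWeight_pos` — the weights `∏_α n_{v_α}/[F:ℚ]` (Remark 3.1.1 (ii) ×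
  dimension) are positive;
* `portionDatum_logVol_mono_of_adm` — the genuine portion log-volume is monotone on ADMISSIBLE subsets
  (campaign-S `tensorLogVolume_mono` at `p`, `nlogVol_mono` at `∞`);
* `capsulePacketLogVolume_mono`, `globalLogVolume_capsuleHaarModel_mono` — hence so are `μ^log_{A,v_ℚ}` and
  `μ^log_{A,𝕍_ℚ}`;
* **`remark3101iii_estimate_haarModelCapsules (α)`** — **F-2097 / IUTchIII:Rmk3.10.1(iii) HOLDS at the genuine
  `A`-packet model for every `A` and every label `α`**: `region_α(𝔍) ⊆ S ⇒ deg(𝔞_𝔍) ≤ μ^log_{A,𝕍_ℚ}(S)`, via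
  abc-iut-L6-d3's `globalLogVolume_idealCapsuleRegion_eq_ndeg` (Prop. 3.9 (iii), all capsule sizes);
  `…_sharp`, `isLeast_globalLogVolume_idealCapsuleRegion` — attained at `region_α(𝔍)`.

HONEST FRAMING: instance form at OUR genuine model (Haar measure on the real tensor packets of local fields
+ Arakelov degree), for the ideal-family objects; not the ∀-closure of the typed schema (refuted), no
Frobenioid `𝓕⊛_𝔪𝔬𝔡` is constructed, the log-Kummer distortions of the Remark are not modelled; no side taken
on [IUTchIII] Cor. 3.12; typed ≠ proved; nothing here asserts abc proved or refuted.
-/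

namespace Literature.IUT.LogThetaLattice

open Literature.IUT.LogVolume Literature.IUT.LogVolume.ArchPacket Literature.IUT.LogVolume.Prop15iii
  Literature.NumberTheory.NumberFields NumberField IsDedekindDomain MeasureTheory Set
open scoped ENNReal

variable (F : Type) [Field F] [NumberField F]
variable (A : Type) [Fintype A] [DecidableEq A] [Nonempty A]

/-! ### Positivity of the weights, monotonicity of the genuine portion log-volumes -/

omit [DecidableEq A] [Nonempty A] in
/-- The one-place weights `n_v/[F:ℚ]`, `[F_w:ℝ]/[F:ℚ]` (Remark 3.1.1 (ii) × dimension) are positive.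
[claim: Mochizuki2012, status: disputed] -/
theorem placeProbWeight_pos (v : Place F) : 0 < placeProbWeight F v := by
  rcases v with w | v
  · exact div_pos (by exact_mod_cast InfinitePlace.mult_pos) (FinDivisor.finrank_pos (F := F))
  · exact div_pos (by exact_mod_cast localDegree_pos F v) (FinDivisor.finrank_pos (F := F))

omit [DecidableEq A] [Nonempty A] in
/-- The portion weights `∏_α placeProbWeight(v_α)` are positive. [claim: Mochizuki2012, status: disputed] -/
theorem portionWeight_pos (q : RatPlace) (π : Portion F A q) : 0 < portionWeight F A q π :=
  Finset.prod_pos fun α _ => placeProbWeight_pos F (π α).1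

/-- On ADMISSIBLE subsets (positive finite Haar / Lebesgue volume — print's "`𝕄(−)`") the genuine portion
log-volume `μ^log_π` is monotone: campaign-S `tensorLogVolume_mono` on `⊗_{α,ℚ_p} F_{v_α}` ([IUTchIV] Prop.
1.4 (i)), `nlogVol_mono` on `⊗_{α,ℝ} ℂ` ([IUTchIV] Prop. 1.5 (iii)). [claim: Mochizuki2012, status: disputed] -/
theorem portionDatum_logVol_mono_of_adm (q : RatPlace) (π : Portion F A q) (S T : (portionDatum F A q π).Adm)
    (h : (S.1 : Set (portionDatum F A q π).X) ⊆ T.1) :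
    (portionDatum F A q π).logVol S.1 ≤ (portionDatum F A q π).logVol T.1 := by
  rcases q with ⟨⟩ | p
  · -- `v_ℚ = ∞`: `μ^log = packetLogVol Φ = nlogVol (Φ '' ·)`
    obtain ⟨S, hS⟩ := S
    obtain ⟨T, hT⟩ := T
    show packetLogVol _ S ≤ packetLogVol _ T
    exact nlogVol_mono _ (image_mono h) hS.1 hT.2
  · -- `v_ℚ = p`: `μ^log = tensorLogVolume`
    haveI : Fact (p : ℕ).Prime := ⟨p.2⟩
    obtain ⟨S, hS⟩ := S
    obtain ⟨T, hT⟩ := T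
    show tensorLogVolume p _ S ≤ tensorLogVolume p _ T
    exact tensorLogVolume_mono p _ hS.1 hT.2 h

/-- **[IUTchIII] Prop. 3.9 (i)** (p. 115) at the genuine `A`-packet model: `μ^log_{A,v_ℚ}(∏_π T_π) = Σ_π w_π·μ^log_π(T_π)`
is monotone under portionwise inclusion of admissible regions. [claim: Mochizuki2012, status: disputed] -/
theorem capsulePacketLogVolume_mono (q : RatPlace) {S T : ∀ π : Portion F A q, (portionDatum F A q π).Adm}
    (h : ∀ π, ((S π).1 : Set (portionDatum F A q π).X) ⊆ (T π).1) :
    capsulePacketLogVolume F A q S ≤ capsulePacketLogVolume F A q T := by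
  unfold capsulePacketLogVolume
  exact Finset.sum_le_sum fun π _ =>
    mul_le_mul_of_nonneg_left (portionDatum_logVol_mono_of_adm F A q π _ _ (h π))
      (portionWeight_pos F A q π).le

/-- **[IUTchIII] Prop. 3.9 (iii)** (p. 117) at the genuine `A`-packet model: the global log-volume
`μ^log_{A,𝕍_ℚ} = Σ_{v_ℚ} μ^log_{A,v_ℚ}` is monotone under portionwise inclusion of global regions.
[claim: Mochizuki2012, status: disputed] -/
theorem globalLogVolume_capsuleHaarModel_mono {S T : GlobalRegion (capsulePacketLogVolume F A)}
    (h : ∀ (q : RatPlace) (π : Portion F A q),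
      ((S.1 q π).1 : Set (portionDatum F A q π).X) ⊆ (T.1 q π).1) :
    globalLogVolume (capsulePacketLogVolume F A) S ≤ globalLogVolume (capsulePacketLogVolume F A) T := by
  unfold globalLogVolume
  exact finsum_le_finsum' S.2 T.2 fun q => capsulePacketLogVolume_mono F A q (h q)

/-! ### Remark 3.10.1 (iii) at the genuine `A`-packet model -/

/-- **F-2097 / IUTchIII:Rmk3.10.1(iii)** (kurims p. 150) HOLDS AT THE GENUINE `A`-PACKET HAAR MODEL, for every
finite nonempty label set `A` and every label `α ∈ A`: for the objects `𝔍 = {J_v}` (`IdealFamily F`), their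
genuine regions in the label `α` (`idealCapsuleRegion F A α`: at `p` the portion region `ι_α(J_{v_α})·(R_I)^∼ ⊆
⊗_β F_{v_β}`, at `∞` the unit polydisc dilated by `e^{t_{w_α}}` in the factor `α`), the normalised arithmetic
degree `deg(𝔞_𝔍) = deg_F(𝔞_𝔍)/[F:ℚ]` (campaign-S `ndeg`) and the global log-volume of Proposition 3.9 (iii) built
from the genuine tensor-packet Haar / Lebesgue measures (`capsulePacketLogVolume`, abc-iut-L6-d3), containment
being portionwise inclusion: `region_α(𝔍) ⊆ S ⇒ deg(𝔞_𝔍) ≤ μ^log_{A,𝕍_ℚ}(S)`. [claim: Mochizuki2012, status: disputed] -/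
theorem remark3101iii_estimate_haarModelCapsules (α : A) :
    @Remark3101iii_estimate (IdealFamily F) (GlobalRegion (capsulePacketLogVolume F A))
      ⟨fun S T => ∀ (q : RatPlace) (π : Portion F A q),
        ((S.1 q π).1 : Set (portionDatum F A q π).X) ⊆ (T.1 q π).1⟩
      (fun J => ndeg F J.toADivisor) (idealCapsuleRegion F A α)
      (globalLogVolume (capsulePacketLogVolume F A)) := by
  intro J S hS
  show ndeg F J.toADivisor ≤ _
  rw [← globalLogVolume_idealCapsuleRegion_eq_ndeg F A α J]
  exact globalLogVolume_capsuleHaarModel_mono F A hS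

/-- The same estimate with the degree displayed as `deg_F(𝔍)/[F:ℚ]`. [claim: Mochizuki2012, status: disputed] -/
theorem remark3101iii_estimate_haarModelCapsules' (α : A) :
    @Remark3101iii_estimate (IdealFamily F) (GlobalRegion (capsulePacketLogVolume F A))
      ⟨fun S T => ∀ (q : RatPlace) (π : Portion F A q),
        ((S.1 q π).1 : Set (portionDatum F A q π).X) ⊆ (T.1 q π).1⟩
      (fun J => J.deg / Module.finrank ℚ F) (idealCapsuleRegion F A α)
      (globalLogVolume (capsulePacketLogVolume F A)) := by
  intro J S hS
  show J.deg / Module.finrank ℚ F ≤ _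
  rw [← globalLogVolume_idealCapsuleRegion F A α J]
  exact globalLogVolume_capsuleHaarModel_mono F A hS

/-- **Sharpness**: the estimate is attained at `region_α(𝔍)` itself (`μ^log_{A,𝕍_ℚ}(region_α 𝔍) = deg(𝔞_𝔍)`,
abc-iut-L6-d3's `globalLogVolume_idealCapsuleRegion_eq_ndeg`). [claim: Mochizuki2012, status: disputed] -/
theorem remark3101iii_estimate_haarModelCapsules_sharp (α : A) (J : IdealFamily F) :
    ∃ S : GlobalRegion (capsulePacketLogVolume F A),
      (∀ (q : RatPlace) (π : Portion F A q),
        (((idealCapsuleRegion F A α J).1 q π).1 : Set (portionDatum F A q π).X) ⊆ (S.1 q π).1) ∧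
      globalLogVolume (capsulePacketLogVolume F A) S = ndeg F J.toADivisor :=
  ⟨idealCapsuleRegion F A α J, fun _ _ => Subset.rfl, globalLogVolume_idealCapsuleRegion_eq_ndeg F A α J⟩

/-- **"compute … the global arithmetic degrees … by computing log-volumes"** at the genuine `A`-packet model:
`deg(𝔞_𝔍)` is the LEAST global log-volume of a global region containing `region_α(𝔍)` portionwise.
[claim: Mochizuki2012, status: disputed] -/
theorem isLeast_globalLogVolume_idealCapsuleRegion (α : A) (J : IdealFamily F) :
    IsLeast {μ : ℝ | ∃ S : GlobalRegion (capsulePacketLogVolume F A),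
        (∀ (q : RatPlace) (π : Portion F A q),
          (((idealCapsuleRegion F A α J).1 q π).1 : Set (portionDatum F A q π).X) ⊆ (S.1 q π).1) ∧
        globalLogVolume (capsulePacketLogVolume F A) S = μ} (ndeg F J.toADivisor) := by
  refine ⟨remark3101iii_estimate_haarModelCapsules_sharp F A α J, ?_⟩
  rintro μ ⟨S, hS, rfl⟩
  exact remark3101iii_estimate_haarModelCapsules F A α J S hS

end Literature.IUT.LogThetaLattice
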